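import Summits.BirchSwinnertonDyer.Rank1Residual.Additive.ThreeAdicModelRamified
import Summits.BirchSwinnertonDyer.Rank1Residual.Additive.SubGordThree
import Summits.BirchSwinnertonDyer.Rank1Residual.Additive.GordDescentField
import Literature.NumberTheory.EllipticCurves.PAdicGrossZagierConstantTermProofs
import Literature.NumberTheory.EllipticCurves.CMNewformOfHeckeCharacterProofs
import Literature.NumberTheory.QuadraticFields.FundamentalDiscriminant
import HarnessLib

/-!
# Additive classes X3/X4 at `p = 3`: over a QUADRATIC field `K`, `E_K` is good above `3`
# iff `E` is of type (G) at `3` and `3 ∣ d_K` (the quadratic-field criterion, `p = 3` column)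

HONEST FRAMING (cell `b2b-bsdres`, run/shared/lean/b2b/bsd-rank1-residual/, verbatim in every
file): the goal of the cell is to DELETE the COMBINATION-SHAPED residual classes of the
Birch–Swinnerton-Dyer formula for ALL analytic-rank `≤ 1` elliptic curves over `ℚ` — "full BSD
formula for every rank `≤ 1` curve in class `C`" assembled STRICTLY from published theorems — so
that the rank-`≤ 1` remainder becomes exactly the CONSTRUCTION-SHAPED classes, which are TYPED
(missing-input `Prop`s), NOT attempted. This is not "finishing BSD". Sub-cell `additive-p2`
(CLASS-OWNERS row "X3/X4 additive — pot. good ordinary / X3♯(G-ord)"), generation 8: research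
route; no claim beyond the stated classes; theorems only, no definition, no named fact;
X3♯(G-ord)/X4♯(G-ord) stay CONSTRUCTION-SHAPED; labels / census / located gap UNCHANGED.

WHAT THIS FILE DOES (gen 7's NEXT (a)). Gen 6 proved, for `p ≥ 5` and `E` additive potentially good
at `p`: over a quadratic field `K`, `E_K` is good at `w ∋ p` iff `e_E(p) = 2 ∧ p ∣ d_K`
(`hasGoodReductionAt_baseChange_quadratic_iff`, `GordDescentField.lean`). At `p = 3` the class
theorems (`GordDescentThree.lean`) ask the over-`K` input over EVERY quadratic `K` with `3 ∣ d_K`,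
while the kernel knew `E_K` good above `3` only for `K = ℚ(√−3)` (and the supply's `ℚ(√−3d')`).
This file proves the `p = 3` column of the criterion:

* `absNorm_eq_of_quadratic_of_dvd_discr` — in a quadratic `K` with `p ∣ d_K`, `N(w) = p` for
  `w ∋ p` (`e = 2`, `∑ e·f = 2`; Mathlib `Ideal.sum_ramification_inertia`,
  `Ideal.absNorm_eq_pow_inertiaDeg'`);
* ⟹ **`typeG_three_of_hasGoodReductionAt_baseChange_quadratic`**: `E_K` good at `w ∋ 3` over ANY
  quadratic `K` with `3 ∣ d_K` ⟹ every globally minimal model of `E^{(−3)}` is good at `3`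
  (`hasGoodReductionAtPrime_twist_three_of_hasGoodReductionAt_baseChange_quadratic`: gen 7's Tate
  algorithm run over `K_w` — `N(w) = 3`, `e(w|3) = 2` — via `ThreeAdicModelRamified.lean`) ⟹ (G);
* ⟸ **`hasGoodReductionAt_baseChange_quadratic_of_typeG_three`**: (G) ∧ additive at `3` ⟹ `E_K`
  good at every `w ∋ 3` of every quadratic `K` with `3 ∣ d_K` (`d_K = 3m`, `3 ∤ m` by
  `Quadratic.not_sq_dvd_discr_of_prime_ne_two`; a globally minimal model `Wd` of `E^{(−3)}` is good at
  `3` by gen 7; its twist by the `3`-unit `−m` is good, tree `hasGoodReductionAt_quadraticTwist`;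
  `Wd^{(−m)} ≅ E^{(d_K)}`, `quadraticTwist_smul` + `quadraticTwist_quadraticTwist`; `√d_K ∈ K` and
  ascent, gen 6's `exists_variableChange_baseChange_eq_quadraticTwist`,
  `hasGoodReductionAt_baseChange_of_hasGoodReductionAt`);
* `dvd_discr_of_addv_three_of_hasGoodReductionAt_baseChange` — good above an additive `3` forces
  `3 ∣ d_K` (Dedekind `ramificationIdxIn_eq_one_of_not_dvd_discr` + gen 0's unramified no-go);
* **`hasGoodReductionAt_baseChange_quadratic_iff_three`**: `E_K` good at `w ∋ 3` ↔
  `TypeG W 3 ∧ 3 ∣ d_K`; in census currency `…_iff_subGord_three` (`SubGord W 3 ∧ 3 ∣ d_K`, via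
  `SubGordThree.lean`); `typeG_three_iff_forall_hasGoodReductionAt_baseChange_quadratic`.

NOTE: at `p = 3` the defect `e = 12/gcd(12, ord₃ Δ_min)` no longer decides (wild types with
`ord₃ Δ = 6` exist); (G) — equivalently the census cell `¬(M) ∧ f₃ = 2 ∧ e ∣ 2` — is the condition.
So the quadratic descent domain of the sub-cell's class theorems is exactly
"(G) × {quadratic `K` : `p ∣ d_K`}" at every `p ≥ 3`. Labels UNCHANGED.

References: J. Tate, LNM 476 (1975) §7; J. H. Silverman, *AEC* VII.5 Prop. 5.1, 5.4; *ATAEC*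
IV.9.4; D. Delbourgo, Compositio Math. 113 (1998) §1.5; D. A. Marcus, *Number Fields*, Ch. 2 Thm. 1;
J. Neukirch, *ANT* III (2.12).
-/

noncomputable section

open scoped Classical NumberField

open WeierstrassCurve IsDedekindDomain IsDedekindDomain.HeightOneSpectrum NumberField
  Rat.HeightOneSpectrum WithZero
  Literature.NumberTheory.EllipticCurves Literature.NumberTheory.EllipticCurves.Rank1Residual

namespace Summit.BirchSwinnertonDyer.Rank1Residual.Additive

/-! ### `N(w) = p` above a prime ramified in a quadratic field -/

section AbsNorm

variable (p : ℕ) [hp : Fact p.Prime] (K : Type) [Field K] [NumberField K]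
  (w : HeightOneSpectrum (𝓞 K))

/-- **In a quadratic field ramified at `p`, the prime `w ∋ p` has norm `p`** (`e(w|p) = 2` by the
tree's `ramificationIdx_eq_two_of_dvd_discr`, and `∑ e·f = [K:ℚ] = 2` forces `f(w|p) = 1`;
Mathlib `Ideal.sum_ramification_inertia`, `Ideal.absNorm_eq_pow_inertiaDeg'`). [folklore] -/
theorem absNorm_eq_of_quadratic_of_dvd_discr (h2 : Module.finrank ℚ K = 2)
    (hdvd : (p : ℤ) ∣ NumberField.discr K) (hw : (p : 𝓞 K) ∈ w.asIdeal) :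
    Ideal.absNorm w.asIdeal = p := by
  haveI := liesOver_span_of_natCast_mem p K w hw
  have he := ramificationIdx_eq_two_of_dvd_discr p K w h2 hdvd hw
  have hpZ : Prime (p : ℤ) := Nat.prime_iff_prime_int.mp hp.out
  haveI hmax : (Ideal.span {(p : ℤ)}).IsMaximal :=
    PrincipalIdealRing.isMaximal_of_irreducible hpZ.irreducible
  have hp0 : Ideal.span {(p : ℤ)} ≠ ⊥ := by
    rw [Ne, Ideal.span_singleton_eq_bot]; exact hpZ.ne_zero
  haveI := w.isPrime
  have hsum := Ideal.sum_ramification_inertia (R := ℤ) (p := Ideal.span {(p : ℤ)}) (𝓞 K) ℚ K hp0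
  rw [h2] at hsum
  have hmem : w.asIdeal ∈ IsDedekindDomain.primesOverFinset (Ideal.span {(p : ℤ)}) (𝓞 K) :=
    (IsDedekindDomain.mem_primesOverFinset_iff hp0 _).mpr ⟨w.isPrime, inferInstance⟩
  have hle : (Ideal.span {(p : ℤ)}).ramificationIdx' w.asIdeal *
      (Ideal.span {(p : ℤ)}).inertiaDeg' w.asIdeal ≤ 2 := by
    rw [← hsum]
    exact Finset.single_le_sum (f := fun P ↦ (Ideal.span {(p : ℤ)}).ramificationIdx' P *
      (Ideal.span {(p : ℤ)}).inertiaDeg' P) (fun _ _ ↦ Nat.zero_le _) hmem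
  rw [he] at hle
  have habs := Ideal.absNorm_eq_pow_inertiaDeg' w.asIdeal hp.out
  have hf : (Ideal.span {(p : ℤ)}).inertiaDeg' w.asIdeal ≤ 1 := by omega
  rcases Nat.le_one_iff_eq_zero_or_eq_one.mp hf with h0 | h1
  · exfalso
    rw [h0, pow_zero] at habs
    exact w.isPrime.ne_top (Ideal.absNorm_eq_one_iff.mp habs)
  · rw [habs, h1, pow_one]

end AbsNorm

/-! ### `p = 3`: over a quadratic field ramified at `3`, good above `3` ⟹ (G) -/

section Forward

variable (W : WeierstrassCurve ℚ) [W.IsElliptic] [W.IsGloballyMinimal]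
  (K : Type) [Field K] [NumberField K] (w : HeightOneSpectrum (𝓞 K))

/-- **Good reduction of `E_K` above `3`, `K` ANY quadratic field ramified at `3`, makes every
globally minimal model of `E^{(−3)}` GOOD at `3`** (`E` bad at `3`): `N(w) = 3`, `e(w|3) = 2`, so the
generalised extraction `exists_rat_of_hasGoodReductionAt_baseChange_three_of_ramified` applies and
`hasGoodReductionAtPrime_twist_three_of_threeAdicData` concludes (Tate's algorithm for tame `I₀*`,
gen 7, run over `K_w` instead of `ℚ(ζ₃)_𝔓`). [cite: SilvermanAEC2009, VII.5 Prop. 5.1(a) and III.1 Table 3.1] -/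
theorem hasGoodReductionAtPrime_twist_three_of_hasGoodReductionAt_baseChange_quadratic
    (h2 : Module.finrank ℚ K = 2) (hdvd : (3 : ℤ) ∣ NumberField.discr K)
    (hw : ((3 : ℕ) : 𝓞 K) ∈ w.asIdeal) (hgood : (W.baseChange K).HasGoodReductionAt w)
    (hbad : ¬ W.HasGoodReductionAtPrime 3) (Wd : WeierstrassCurve ℚ) [Wd.IsElliptic]
    [Wd.IsGloballyMinimal] (C : VariableChange ℚ)
    (hWd : C • W.quadraticTwist ((-1 : ℚ) ^ ((3 : ℕ) / 2) * (3 : ℕ)) = Wd) :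
    Wd.HasGoodReductionAtPrime 3 := by
  have hN : Ideal.absNorm w.asIdeal = 3 := absNorm_eq_of_quadratic_of_dvd_discr 3 K w h2 hdvd hw
  have he := ramificationIdx_eq_two_of_dvd_discr 3 K w h2 hdvd hw
  obtain ⟨k, ρ, hk, -, h₂, h₄, h₆⟩ :=
    exists_rat_of_hasGoodReductionAt_baseChange_three_of_ramified W w hw hN he hgood
  exact hasGoodReductionAtPrime_twist_three_of_threeAdicData W hk h₂ h₄ h₆ hbad Wd C hWd

/-- **Good reduction of `E_K` above `3` over ANY quadratic field ramified at `3` ⟹ Delbourgo's (G) at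
`3`** for `E` additive at `3` (the twist `E^{(−3)}` is good at `3`, then gen 0's
`typeG_of_hasGoodReductionAtPrime_quadraticTwist`: good over `ℚ(√−3) ⊆ ℚ(ζ₃)`). -/
theorem typeG_three_of_hasGoodReductionAt_baseChange_quadratic (h2 : Module.finrank ℚ K = 2)
    (hdvd : (3 : ℤ) ∣ NumberField.discr K) (hw : ((3 : ℕ) : 𝓞 K) ∈ w.asIdeal)
    (hgood : (W.baseChange K).HasGoodReductionAt w) (hadd : Addv W 3) : TypeG W 3 := by
  haveI := W.isElliptic_quadraticTwist (pStar_ne_zero 3)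
  obtain ⟨C₁, hCmin⟩ :=
    hasGlobalMinimalModel_rat_holds (W.quadraticTwist ((-1 : ℚ) ^ ((3 : ℕ) / 2) * (3 : ℕ)))
  haveI := hCmin
  have hgoodWd := hasGoodReductionAtPrime_twist_three_of_hasGoodReductionAt_baseChange_quadratic W K
    w h2 hdvd hw hgood hadd.1 (C₁ • W.quadraticTwist ((-1 : ℚ) ^ ((3 : ℕ) / 2) * (3 : ℕ))) C₁ rfl
  exact typeG_of_hasGoodReductionAtPrime_quadraticTwist W 3 (by norm_num)
    ((hasGoodReductionAtPrime_iff_of_variableChange _ C₁ 3).mp hgoodWd)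

end Forward

/-! ### `p = 3`: (G) ⟹ good above `3` over EVERY quadratic field ramified at `3` -/

section Backward

variable (W : WeierstrassCurve ℚ) [W.IsElliptic] [W.IsGloballyMinimal]
  (K : Type) [Field K] [NumberField K] (w : HeightOneSpectrum (𝓞 K))

/-- **(G) at an additive `3` ⟹ `E_K` good above `3` over every quadratic `K` with `3 ∣ d_K`.** With
`d_K = 3m`, `3 ∤ m` (no odd square factor in a fundamental discriminant,
`Quadratic.not_sq_dvd_discr_of_prime_ne_two`): a globally minimal model `Wd` of `E^{(−3)}` is good
at `3` (gen 7's `hasGoodReductionAtPrime_twist_three_of_typeG_of_addv`), so its twist by the `3`-adic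
unit `−m` is good at `3` (tree `hasGoodReductionAt_quadraticTwist`), and
`Wd^{(−m)} ≅ E^{(3m)} = E^{(d_K)}` (`quadraticTwist_smul`, `quadraticTwist_quadraticTwist`); finally
`E_K ≅ (E^{(d_K)})_K` (`√d_K ∈ K`, gen 6's `exists_variableChange_baseChange_eq_quadraticTwist`) and
good reduction ascends (`hasGoodReductionAt_baseChange_of_hasGoodReductionAt`).
[cite: SilvermanAEC2009, VII.5 Prop. 5.1(a)] -/
theorem hasGoodReductionAt_baseChange_quadratic_of_typeG_three (hG : TypeG W 3) (hadd : Addv W 3)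
    (h2 : Module.finrank ℚ K = 2) (hdvd : (3 : ℤ) ∣ NumberField.discr K)
    (hw : ((3 : ℕ) : 𝓞 K) ∈ w.asIdeal) : (W.baseChange K).HasGoodReductionAt w := by
  haveI : NeZero (2 : ℚ) := ⟨two_ne_zero⟩
  -- `d_K = 3m`, `3 ∤ m`
  obtain ⟨m, hm⟩ := hdvd
  have h3m : ¬ (3 : ℤ) ∣ m := by
    intro h
    refine Literature.NumberTheory.QuadraticFields.Quadratic.not_sq_dvd_discr_of_prime_ne_two
      (K := K) h2 Nat.prime_three (by decide) ?_
    rw [hm, pow_two]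
    exact mul_dvd_mul_left 3 h
  -- the place of `𝓞 ℚ` at `3`
  set u₃ : HeightOneSpectrum (𝓞 ℚ) := (primesEquiv (R := 𝓞 ℚ)).symm ⟨3, Nat.prime_three⟩
    with hu₃def
  have hu₃ : ((3 : ℕ) : 𝓞 ℚ) ∈ u₃.asIdeal :=
    (natCast_mem_asIdeal_iff_eq_primesEquiv_symm u₃ Nat.prime_three).mpr rfl
  have hv3 : (primesEquiv u₃ : ℕ) = 3 := by rw [hu₃def, Equiv.apply_symm_apply]
  -- `Wd`, a globally minimal model of `E^{(−3)}`, good at `3`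
  haveI := W.isElliptic_quadraticTwist (pStar_ne_zero 3)
  obtain ⟨C₁, hCmin⟩ :=
    hasGlobalMinimalModel_rat_holds (W.quadraticTwist ((-1 : ℚ) ^ ((3 : ℕ) / 2) * (3 : ℕ)))
  haveI := hCmin
  set Wd := C₁ • W.quadraticTwist ((-1 : ℚ) ^ ((3 : ℕ) / 2) * (3 : ℕ)) with hWddef
  have hgoodWd : Wd.HasGoodReductionAtPrime 3 :=
    hasGoodReductionAtPrime_twist_three_of_typeG_of_addv W hG hadd Wd ⟨C₁, rfl⟩
  have hΔ : ¬ ((3 : ℕ) : ℤ) ∣ minimalDiscriminantInt Wd :=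
    Wd.not_dvd_minimalDiscriminantInt_of_hasGoodReductionAtPrime 3 hgoodWd
  -- its twist by the unit `−m` is good at `3`
  have hgoodTw : (Wd.quadraticTwist ((-m : ℤ) : ℚ)).HasGoodReductionAt u₃ := by
    refine Wd.hasGoodReductionAt_quadraticTwist u₃ ?_ (by rw [hv3]; exact hΔ)
    rw [hv3]
    intro h
    have h' : (3 : ℤ) ∣ 2 * m := by
      have := (dvd_neg).mpr h
      simpa using this
    rcases (Int.prime_three.dvd_or_dvd h') with h3 | h3
    · norm_num at h3
    · exact h3m h3
  -- `Wd^{(−m)} ≅ E^{(d_K)}`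
  have hX : (Wd.quadraticTwist ((-m : ℤ) : ℚ)) =
      (⟨C₁.u, ((-m : ℤ) : ℚ) * C₁.r, 0, 0⟩ : VariableChange ℚ) •
        W.quadraticTwist (NumberField.discr K : ℚ) := by
    rw [hWddef, quadraticTwist_smul _ two_ne_zero, quadraticTwist_quadraticTwist, pStar_three, hm]
    push_cast
    ring_nf
  have hdK0 : (NumberField.discr K : ℚ) ≠ 0 := by exact_mod_cast NumberField.discr_ne_zero K
  haveI := W.isElliptic_quadraticTwist hdK0
  have hgoodX : (W.quadraticTwist (NumberField.discr K : ℚ)).HasGoodReductionAt u₃ := by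
    rw [hX] at hgoodTw
    exact (hasGoodReductionAt_smul_iff_holds u₃ _ _).mp hgoodTw
  -- up to `K`: `(E^{(d_K)})_K` good at `w`, and `E_K ≅ (E^{(d_K)})_K`
  have hwv : w.asIdeal.under (𝓞 ℚ) = u₃.asIdeal := under_eq_asIdeal_of_natCast_mem 3 w hw
  haveI : w.asIdeal.LiesOver u₃.asIdeal := ⟨hwv.symm⟩
  have hgoodXK : ((W.quadraticTwist (NumberField.discr K : ℚ)).baseChange K).HasGoodReductionAt w :=
    hasGoodReductionAt_baseChange_of_hasGoodReductionAt _ K u₃ w hgoodX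
  obtain ⟨-, -, δ, -, hδ⟩ := Literature.NumberTheory.QuadraticFields.Quadratic.exists_sq_eq_discr h2
  have hk : ((δ : 𝓞 K) : K) ^ 2 = algebraMap ℚ K (NumberField.discr K : ℚ) := by
    have hk' := congrArg (fun x : 𝓞 K ↦ (x : K)) hδ
    push_cast at hk'
    rw [map_intCast]
    exact hk'
  have hk0 : ((δ : 𝓞 K) : K) ≠ 0 := by
    intro h
    rw [h, zero_pow two_ne_zero, map_intCast] at hk
    exact (Int.cast_ne_zero.mpr (NumberField.discr_ne_zero K)) hk.symm
  obtain ⟨C, hC⟩ := exists_variableChange_baseChange_eq_quadraticTwist W K hk hk0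
  rw [← hC] at hgoodXK
  exact (hasGoodReductionAt_smul_iff_holds w (W.baseChange K) C).mp hgoodXK

end Backward

/-! ### The criterion over all quadratic fields at `p = 3` -/

section Criterion

variable (W : WeierstrassCurve ℚ) [W.IsElliptic] [W.IsGloballyMinimal]
  (K : Type) [Field K] [NumberField K] (w : HeightOneSpectrum (𝓞 K))

omit [W.IsGloballyMinimal] in
/-- **Good reduction above an additive `3` forces `3 ∣ d_K`** (quadratic `K`): otherwise `3` is
unramified in `K` (Dedekind, `ramificationIdxIn_eq_one_of_not_dvd_discr`) and additive reduction
persists in unramified Galois extensions (gen 0's `hasAdditiveReductionAt_baseChange_of_addv_of_unramified`,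
the unramified Artin formalism). The `p = 3` twin of gen 6's
`dvd_discr_of_addv_of_hasGoodReductionAt_baseChange` (`p ≥ 5`). -/
theorem dvd_discr_of_addv_three_of_hasGoodReductionAt_baseChange (hadd : Addv W 3)
    (h2 : Module.finrank ℚ K = 2) (hw : ((3 : ℕ) : 𝓞 K) ∈ w.asIdeal)
    (hgood : (W.baseChange K).HasGoodReductionAt w) : (3 : ℤ) ∣ NumberField.discr K := by
  by_contra hnd
  haveI : Algebra.IsQuadraticExtension ℚ K := ⟨h2⟩
  haveI : IsGalois ℚ K := inferInstance
  set v : HeightOneSpectrum (𝓞 ℚ) := (primesEquiv (R := 𝓞 ℚ)).symm ⟨3, Nat.prime_three⟩ with hvdef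
  have hv3 : (primesEquiv v : ℕ) = 3 := by rw [hvdef, Equiv.apply_symm_apply]
  have he : v.asIdeal.ramificationIdxIn (𝓞 K) = 1 :=
    ModularForms.ramificationIdxIn_eq_one_of_not_dvd_discr K v (by
      change ¬ ((primesEquiv v : ℕ) : ℤ) ∣ NumberField.discr K
      rw [hv3]; exact_mod_cast hnd)
  have hwv : w.asIdeal.under (𝓞 ℚ) = v.asIdeal := under_eq_asIdeal_of_natCast_mem 3 w hw
  exact (hasAdditiveReductionAt_baseChange_of_addv_of_unramified W 3 K hadd hwv he).not_hasGoodReductionAt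
    hgood

/-- **THE QUADRATIC-FIELD CRITERION AT `p = 3`.** For `E/ℚ` (globally minimal `W`) ADDITIVE at `3`,
a quadratic field `K` and a prime `w ∋ 3` of `K`:
`E_K` has good reduction at `w` **iff** `E` is of Delbourgo type (G) at `3` **and** `3 ∣ d_K`.
The `p = 3` twin of gen 6's `hasGoodReductionAt_baseChange_quadratic_iff` (`p ≥ 5`, where (G) on the
defect-`2` cell reads `e_E(p) = 2`); at `p = 3` the defect `e = 12/gcd(12, ord₃ Δ_min)` no longer
decides (wild types with `ord₃ Δ = 6` exist) — (G) itself, equivalently the census cell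
`SubGord W 3` (`SubGordThree.lean`), is the condition. So the quadratic descent domain of the
sub-cell's class theorems is EXACTLY "(G) × {quadratic `K` : `3 ∣ d_K`}" at `p = 3` too. -/
theorem hasGoodReductionAt_baseChange_quadratic_iff_three (hadd : Addv W 3)
    (h2 : Module.finrank ℚ K = 2) (hw : ((3 : ℕ) : 𝓞 K) ∈ w.asIdeal) :
    (W.baseChange K).HasGoodReductionAt w ↔ TypeG W 3 ∧ (3 : ℤ) ∣ NumberField.discr K := by
  constructor
  · intro hgood
    have hdvd := dvd_discr_of_addv_three_of_hasGoodReductionAt_baseChange W K w hadd h2 hw hgood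
    exact ⟨typeG_three_of_hasGoodReductionAt_baseChange_quadratic W K w h2 hdvd hw hgood hadd, hdvd⟩
  · rintro ⟨hG, hdvd⟩
    exact hasGoodReductionAt_baseChange_quadratic_of_typeG_three W K w hG hadd h2 hdvd hw

/-- The same in CENSUS currency: `E_K` good at `w ∋ 3` iff `SubGord W 3 ∧ 3 ∣ d_K`
(`subGord_three_iff_typeG`). -/
theorem hasGoodReductionAt_baseChange_quadratic_iff_subGord_three (hadd : Addv W 3)
    (h2 : Module.finrank ℚ K = 2) (hw : ((3 : ℕ) : 𝓞 K) ∈ w.asIdeal) :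
    (W.baseChange K).HasGoodReductionAt w ↔ SubGord W 3 ∧ (3 : ℤ) ∣ NumberField.discr K := by
  rw [hasGoodReductionAt_baseChange_quadratic_iff_three W K w hadd h2 hw, subGord_three_iff_typeG W hadd]

/-- **Over a quadratic field ramified at `3`, `E_K` is good above `3` at one prime iff at all, iff
(G)** — the `p = 3` complement of gen 6's `forall_hasGoodReductionAt_adjoin_sqrt_pStar_iff`. -/
theorem typeG_three_iff_forall_hasGoodReductionAt_baseChange_quadratic (hadd : Addv W 3)
    (h2 : Module.finrank ℚ K = 2) (hdvd : (3 : ℤ) ∣ NumberField.discr K) :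
    TypeG W 3 ↔ ∀ w : HeightOneSpectrum (𝓞 K), ((3 : ℕ) : 𝓞 K) ∈ w.asIdeal →
      (W.baseChange K).HasGoodReductionAt w := by
  constructor
  · intro hG w hw
    exact hasGoodReductionAt_baseChange_quadratic_of_typeG_three W K w hG hadd h2 hdvd hw
  · intro h
    obtain ⟨w, hw⟩ := exists_heightOneSpectrum_natCast_mem K 3
    exact typeG_three_of_hasGoodReductionAt_baseChange_quadratic W K w h2 hdvd hw (h w hw) hadd

end Criterion

end Summit.BirchSwinnertonDyer.Rank1Residual.Additive

end
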